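import Summits.Ventures.QEC.Census.CSSNormalFormSAT.BridgeX
import Summits.Ventures.QEC.Census.CSSNormalFormSAT.Reindex
import Summits.Ventures.QEC.Census.CSSNormalFormSAT.SortSupport
import HarnessLib

/-!
# The Boolean normal form of a CSS `[[16,1,≥ 5]]` code (KERNEL-PLAN item 3a, complete)

`boolean_normalForm_of_css`: a CSS code on `Fin 16` with `k = 1`, `dX ≥ 5`, `dZ ≥ 5` yields `b = rank H^Z`, `w` with `5 ≤ w ≤ 16 − b` and a matrix
`A' : Matrix (Fin b) (Fin (16−b)) (ZMod 2)` whose Boolean image satisfies the counting conditions `ZCond`/`XCond` of the encoder at `(16,5,b,w)`: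
`CSSNormalForm.exists_normalForm` (𝔽₂ normal form over the information set `I`), reindexed along `{q ∈ I} ≃ Fin b` and the SORTING bijection
of `SortSupport.exists_sorting_equiv` (so that `s` becomes `sVec = 1^w 0^{m−w}`), transported by `Reindex.condZ_reindex/condX_reindex`, then
`BridgeZ.ZCond_of_Z` / `BridgeX.XCond_of_X`. With the double-lex representative lemma (item 3b, to come) and the landed `noNF_16_5_b*_w*` this closes
census cell `(16,1)` in the kernel. [folklore]
-/

set_option autoImplicit false

namespace Summit.Ventures.QEC.Census.CSSNormalFormSAT

open Matrix NFEnc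

section Glue
open Literature.InformationTheory.QuantumCodes

/-- **Boolean normal form of a CSS `[[16,1,≥5]]` code** (KERNEL-PLAN item 3a complete): reindex + sort the 𝔽₂ normal form of
`CSSNormalForm.exists_normalForm` and pass to the counting conditions. [folklore] -/
theorem boolean_normalForm_of_css {RX RZ : Type} [Fintype RX] [Fintype RZ]
    (C : CSSCode RX RZ (Fin 16)) (hk : C.k = 1) (hX5 : 5 ≤ C.dX) (hZ5 : 5 ≤ C.dZ) :
    ∃ (b w : ℕ) (A' : Matrix (Fin b) (Fin (16 - b)) (ZMod 2)), b = C.HZ.rank ∧ 5 ≤ w ∧ w ≤ 16 - b ∧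
      ZCond ⟨16, 5, b, w⟩ (boolOf ⟨16, 5, b, w⟩ A') ∧ XCond ⟨16, 5, b, w⟩ (boolOf ⟨16, 5, b, w⟩ A') := by
  classical
  obtain ⟨I, A, s, hI, hs, hZ, hX⟩ := CSSNormalForm.exists_normalForm C hk
  set b := I.card with hb
  have hcardκ : Fintype.card {q // q ∈ I} = b := by simp [hb]
  have hcardμ : Fintype.card {q // q ∉ I} = 16 - b := by
    rw [Fintype.card_subtype_compl, Fintype.card_fin, hcardκ]
  let eκ : {q // q ∈ I} ≃ Fin b := Fintype.equivFinOfCardEq hcardκ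
  obtain ⟨eμ0, heμ0⟩ := exists_sorting_equiv s
  let eμ : {q // q ∉ I} ≃ Fin (16 - b) := eμ0.trans (finCongr hcardμ)
  set w := hammingNorm s with hw
  let c : NFEnc.Cfg := ⟨16, 5, b, w⟩
  let A' : Matrix (Fin b) (Fin (16 - b)) (ZMod 2) := A.submatrix eκ.symm eμ.symm
  have hsv : s ∘ eμ.symm = sVec c := by
    funext j
    have hj := heμ0 ((finCongr hcardμ).symm j)
    simp only [Function.comp_apply, sVec]
    have z2 : ∀ x : ZMod 2, x ≠ 1 → x = 0 := by decide
    by_cases hjw : j.val < w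
    · rw [if_pos hjw]; exact hj.2 (by simpa using hjw)
    · rw [if_neg hjw]; exact z2 _ (fun h => hjw (by simpa using hj.1 h))
  have hw5 : 5 ≤ w := by
    have h0 := hZ 0
    simp only [hammingNorm_zero, Matrix.zero_vecMul, zero_add] at h0
    exact hZ5.trans h0
  have hwm : w ≤ 16 - b := by
    rw [← hcardμ]; exact hammingNorm_le_card_fintype
  have hZ' := condZ_reindex eκ eμ A s 5 (fun v => hZ5.trans (hZ v))
  have hX' := condX_reindex eκ eμ A s 5 (fun u hu => hX5.trans (hX u hu))
  rw [hsv] at hZ' hX'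
  exact ⟨b, w, A', by simpa [hb] using hI, hw5, hwm, ZCond_of_Z c A' hZ', XCond_of_X c A' hX'⟩

end Glue

end Summit.Ventures.QEC.Census.CSSNormalFormSAT
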